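import Summits.QuantumFields.BalabanUV.T4Continuum.Spine.NE1p.DressedSmallFieldRecordLabelsSlot
import Summits.QuantumFields.BalabanUV.T4Continuum.Support.SubstrateNestedToriOfRecord

/-!
# T⁴ programme, spine estimate NE1′ (node O3b/H2) — N0y's ENDs AT THE CARRIERS OF RECORD: the second-step small-field ENDs (table pencil,
# road P1's source pencil) for ROW NE5's CATALOGUE ACTIVITY `Z ↦ Σ_{ℓ' ∈ innerLabels (b13InnerData R) (k+1) (domEmb R (k+1) Z)} actOfLetters ℓA
# (domEmb R (k+1) Z) ℓ'` on the carriers' scale-`(k+1)` torus — `emb`∕`hscale`∕`terms`∕`hact`∕`hadm` DISCHARGED from the substrate's transport (A)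
# and PART 1; (B1b)'s indexing residue at NE5's index REDUCED to the owner's FILTER (print's finer constraints, definitional) + the χ-letter
# condition `hkill` (NE5's identification) — owner node N1a PART 2

Cell `pub-balaban`, sub-cell `t4`, BINDER-OWNERS row NE1′; owner lineage t4-ne1p-p1 (PROVER seat P1), generation 31; owner node N1a,
(D1) PART 2 of 2.  ADDITIVE — imports PART 1 `Spine/NE1p/DressedSmallFieldRecordLabelsSlot` (→ S53, (B), N0y∕N0r∕N0s) and substrate W-23 =
(A) `Support/SubstrateNestedToriOfRecord` (substrate-p1 g6, p238735 ✓: `domEmb`-level `fineEmb`, `InnerLabel.ofTorus`∕`ofTorus_injective`,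
`torusLabels`∕`mem_torusLabels_iff`, `sum_innerLabels_domEmb_eq`) ONLY; THEOREMS ONLY (0 def, 0 `def … : Prop`, 0 cite); used BY NAME.

WHAT (the carriers of record `R : TwoRuns G`, output scale `k+1`, `hk : k + 1 + m′ ≤ m + K` displayed as in (A)).
* §2 **`attachedPart_locE_le_of_actOfLetters_recordLabels_carriers`** ∕ **`muPart_locE_le_of_actOfLetters_recordLabels_carriers`** — PART 1's
  ENDs ONCE at `C := R.carriers`, `N := R.cubesPerDir (k+1)`, `L := R.F.L`, `emb := domEmb R (k+1)` (`hscale` by `rfl`), `T := torusLabels hk`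
  (the pull-back of NE5's catalogue, (A)), `φ := InnerLabel.ofTorus hk` (injective, (A)), `terms₀ Z := (torusLabels hk Z).filter (Z₀ =
  trefineDom L N Z ∧ P ⊆ bondsOf (Z₀ ∖ ∪fam) ∧ #(Z₀ ∖ ∪fam) ≤ 2·#P)` — THE OWNER's FILTER = print's finer constraints p.12∕p.18 + N0u's
  sub-case, a decidable predicate on labels —, `hadm` DISCHARGED (clauses 1∕3∕4 by `Finset.mem_filter`, clause 2 «Y within Z₀» by (A)'s
  `mem_torusLabels_iff`), and the conclusion stated for ROW NE5's CATALOGUE ACTIVITY (= `B13OutKPForm.activity` at the slot letters `ℓA`; for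
  the slots of record `ℓA := coreLettersOf … L.A` by `slotsOfRecord_act`, `rfl`) via (A)'s `sum_innerLabels_domEmb_eq`.
ROAD P1 at the carriers: in the μ-END the source window `μ₁`∕`μ₀`∕`sμ` and the direction `v` occur ONLY in `hH`, `hAmp` and the conclusion.
WHAT STAYS DISPLAYED (by name; NOTHING instantiated on Bałaban's densities): `hroom`; `hm`∕`hN`∕`hq`; `hO`∕`hH`; **`hkill`** — WHICH catalogue
labels the calibration kills = NE5's identification of (2.14) (d2's «zero terms» as the χ-letter `(b, thr ≤ 0, true)`, substrate ANSWER (c));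
**`hAmp`** on the filtered labels ((B3-form) READING, p.18's clause KIND at `C₃(E₀+D₀)`); `bondsOf`∕`hb₀` (generic; (A′) `SubstrateBondsOfCubes`
will supply `b₀ = 4·L^{4m′}`); the located clauses and N0m's `hϱ`∕`hϱA` ∕ road P1's `h0`∕`h01`∕`hμ`.  (B1b) AT THIS INDEX AFTER THIS FILE:
`emb`∕`hscale` rfl-level, `terms`∕`hact`∕`hadm` DISCHARGED modulo the FILTER (owner's READING of print's constraints, definitional) and
`hkill` (NE5's READING); the identification of NE5's `InnerLabel`∕`actOfLetters` FORMAT with Bałaban's resummed (2.14)-terms remains NE5's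
READING — nothing of (B1b) is discharged ON BAŁABAN's DENSITIES.

PRINTED LOCI (TYPE∕CONTEXT only — [Balaban1988RGII] = CMP 116 (1988)): p. 12 «𝐃 ⊂ 𝐃_k», «the smallest localization domain Z₀ ∈ 𝐃_k
containing Y₀ and P … bonds of P … in the interior of Z₀»; p. 14 (2.9) «H(Z) = Σ_{Z₀} H(Z, Z₀)»; p. 15 (2.14) (label `(Z₀, 𝐃, P)`, «Y ⊂ Z₀,
and Z̃₀ ⊂ Z ⊂ X»); p. 18 «|P| ≥ ½M⁻⁴|Z₀∖Y₀|».  pv22's ∕ the substrate's READING: `tsys`∕`torusTreeLen`∕`trefineDom`∕`domEmb`∕`fineEmb` model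
Bałaban's 𝐃_k ⊂ 𝐃_{k+1} ∕ d_k ∕ refinement — asserted nowhere.  Nothing here is used as a fact about Bałaban's densities.

HONEST FRAMING.  By-name applications over binder SHAPES on CONSTRUCTED tori ∕ carriers; cores ∕ labels ∕ slot letters are the cell's typed
FORMAT of (2.14) and NE5's label TYPE, NOT Bałaban's functions; 0 binders instantiated on Bałaban's (2.14) densities; no wall item moves;
wall v1.8 (T4-DAG v48 — words, not kind) does NOT move; R-t4r2-Q2 NOT met thereby; NE1′ ⇐ the named binders — NOT printed, NOT proved;
spine PROVED 0∕9; count 9 unchanged.  ABSOLUTE RULE honoured ([folklore] kernel theorems only; printed loci TYPE∕CONTEXT).  Rung (B)+1 on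
ONE finite four-torus — NOT infinite volume, NOT a mass gap, NOT OS on ℝ⁴, NOT Clay.  HONEST DEPENDENCY: continuum YM on T⁴ ⇐ BetaPertH ∧
nine spine estimates (0/9 proved); BetaPertH ⇐ (D1) ∧ (D4) ∧ CAP+tail; G-an2-4 gates asym, D1 and NE2/3/4. -/

noncomputable section

namespace Summit.QuantumFields.BalabanUV.T4Continuum.NE1p.DressedSmallFieldRecordLabelsCarriers

open Metric Set Complex MeasureTheory
open scoped BigOperators
open Literature.MathematicalPhysics.QuantumFieldTheory.Balaban1983to89 (GaugeGroup)
open Literature.MathematicalPhysics.QuantumFieldTheory.Balaban1983to89.T4OutputRate (Carriers)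
open Literature.MathematicalPhysics.QuantumFieldTheory.Balaban1983to89.B13Resummation (locE locE_congr)
open Literature.MathematicalPhysics.QuantumFieldTheory.Balaban1983to89.TreeLengthTorus (TPt TDom tsys torusTreeLen)
open Literature.MathematicalPhysics.QuantumFieldTheory.Balaban1983to89.TreeLengthTorusGeometry (TTouch tgeometry)
open Literature.MathematicalPhysics.QuantumFieldTheory.Balaban1983to89.B12TreeDecay (K₀)
open Summit.QuantumFields.BalabanUV.T4Continuum.B13HistMeasurable (MeasPotFrame B13HistM)
open Summit.QuantumFields.BalabanUV.T4Continuum.B13StepTermLabels (InnerLabel innerLabels)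
open Summit.QuantumFields.BalabanUV.T4Continuum.B13Carriers (TwoRuns)
open Summit.QuantumFields.BalabanUV.T4Continuum.B13InnerData (Bnd b13InnerData)
open Summit.QuantumFields.BalabanUV.T4Continuum.B13DomainGeometryTR (domEmb)
open Summit.QuantumFields.BalabanUV.T4Continuum.SubstrateActivities (CoreLetters coreOf actOfLetters)
open Summit.QuantumFields.BalabanUV.T4Continuum.SubstrateNestedToriOfRecord (fineEmb InnerLabel.ofTorus InnerLabel.ofTorus_injective
  torusLabels mem_torusLabels_iff sum_innerLabels_domEmb_eq)
open Summit.QuantumFields.BalabanUV.T4Continuum.TorusBlockRefinement (trefineDom)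
open Summit.QuantumFields.BalabanUV.T4Continuum.NE1p.DressedSmallFieldRecordLabelsSlot
  (attachedPart_locE_le_of_actOfLetters_recordLabels_refined muPart_locE_le_of_actOfLetters_recordLabels_refined)

/-! ## §2 AT THE CARRIERS OF RECORD: NE5's CATALOGUE ACTIVITY, `emb`∕`hscale`∕`terms`∕`hact`∕`hadm` DISCHARGED by (A) ∕ (B) and the FILTER -/

section Carriers

variable {G : Type} [GaugeGroup G] (R : TwoRuns G) {k : ℕ} (hk : k + 1 + R.m' ≤ R.F.m + R.K)
variable (P : MeasPotFrame R.carriers) (Op : Type*) [NormedAddCommGroup Op] [NormedSpace ℂ Op]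
  (𝒴 : R.carriers.Dom → InnerLabel R.carriers.Dom (Bnd R) → Type) [∀ X j, Fintype (𝒴 X j)] (dom : ∀ X j, 𝒴 X j → R.carriers.Dom)
  (Jc : R.carriers.Dom → InnerLabel R.carriers.Dom (Bnd R) → Type) [∀ X j, Fintype (Jc X j)]
  (V : R.carriers.Dom → InnerLabel R.carriers.Dom (Bnd R) → Type) [∀ X j, NormedAddCommGroup (V X j)]
  [∀ X j, InnerProductSpace ℝ (V X j)] [∀ X j, MeasurableSpace (V X j)] [∀ X j, BorelSpace (V X j)] [∀ X j, FiniteDimensional ℝ (V X j)]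

open Classical in
/-- **THE ATTACHED PART OF ROW NE5's CATALOGUE ACTIVITY AT THE CARRIERS OF RECORD, THE SECOND-STEP COUNT AND THE INDEXING DISCHARGED**
(kernel; §1's attached END ONCE at `C := R.carriers`, `N := R.cubesPerDir (k+1)`, `L := R.F.L`, `emb := domEmb R (k+1)` (`hscale` `rfl`),
`T := torusLabels hk` (A), `φ := InnerLabel.ofTorus hk` (injective, (A)), `terms₀ Z := (torusLabels hk Z).filter` THE OWNER's FILTER
(`Z₀ = trefineDom L N Z`, `P ⊆ bondsOf (Z₀ ∖ ∪fam)`, `#(Z₀ ∖ ∪fam) ≤ 2·#P` — print's finer constraints + N0u's sub-case), `hadm` DISCHARGED by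
`Finset.mem_filter` and (A)'s `mem_torusLabels_iff` («Y within Z₀»), and the conclusion moved to the catalogue sum by (A)'s
`sum_innerLabels_domEmb_eq`).  Displayed: `hroom`, `hm`∕`hN`∕`hq`, `hO`∕`hH`; `hkill` (every catalogue label failing the filter carries a killing
χ-letter — NE5's identification); (B3-form) `hAmp` on the filtered labels; `bondsOf`∕`hb₀`; the located clauses; N0m's `hϱ`∕`hϱA`.  Conclusion:
`‖E[Z ↦ Σ_{ℓ' ∈ innerLabels (b13InnerData R) (k+1) (domEmb R (k+1) Z)} actOfLetters ℓA (domEmb R (k+1) Z) ℓ' o (h₀ + w)](X₀) − E[… o h₀](X₀)‖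
≤ 4·(e·9·64·K₀(64,8)²)·A₁·e^{−r₁·torusTreeLen X₀}`. [folklore] -/
theorem attachedPart_locE_le_of_actOfLetters_recordLabels_carriers {Win : Set (ℕ → ℝ)}
    {ctr : ℕ → (ℕ → ℝ) → R.carriers.BgB → Op × B13HistM P} {ROp RHist R' : ℕ → ℝ}
    (ℓA : ∀ X j, CoreLetters P Op 𝒴 dom Jc V X j)
    {mq bq N₀ : ℕ → R.carriers.Dom × InnerLabel R.carriers.Dom (Bnd R) → R.carriers.Dom → ℝ}
    (hroom : ∀ k, ROp k < R' k)
    (hm : ∀ k, ∀ g ∈ Win, ∀ (U : R.carriers.BgB) (X : R.carriers.Dom), R.carriers.scale X = k → ∀ p, 0 < mq k p X)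
    (hN : ∀ k, ∀ g ∈ Win, ∀ (U : R.carriers.BgB) (X : R.carriers.Dom), R.carriers.scale X = k →
      ∀ p : R.carriers.Dom × InnerLabel R.carriers.Dom (Bnd R),
      (∀ o ∈ ball (ctr k g U).1 (R' k),
        AEStronglyMeasurable ((ℓA p.1 p.2).N o) (coreOf P Op 𝒴 dom Jc V ℓA p.1 p.2).lam) ∧
      (∀ a, DifferentiableOn ℂ (fun o => (ℓA p.1 p.2).N o a) (ball (ctr k g U).1 (R' k))) ∧
      (∀ o ∈ ball (ctr k g U).1 (R' k), ∀ a, ‖(ℓA p.1 p.2).N o a‖ ≤ N₀ k p X))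
    (hq : ∀ k, ∀ g ∈ Win, ∀ (U : R.carriers.BgB) (X : R.carriers.Dom), R.carriers.scale X = k →
      ∀ p : R.carriers.Dom × InnerLabel R.carriers.Dom (Bnd R),
      (∀ o ∈ ball (ctr k g U).1 (R' k),
        AEStronglyMeasurable (Function.uncurry ((ℓA p.1 p.2).q o))
          ((coreOf P Op 𝒴 dom Jc V ℓA p.1 p.2).lam.prod volume)) ∧
      (∀ a v, DifferentiableOn ℂ (fun o => (ℓA p.1 p.2).q o a v) (ball (ctr k g U).1 (R' k))) ∧
      (∀ o ∈ ball (ctr k g U).1 (R' k), ∀ a v, mq k p X * ‖v‖ ^ 2 - bq k p X ≤ ((ℓA p.1 p.2).q o a v).re))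
    {g : ℕ → ℝ} (hg : g ∈ Win) {U : R.carriers.BgB} {o : Op} {h₀ w : B13HistM P} {ϱ : ℝ}
    (hO : ‖o - (ctr (k + 1) g U).1‖ ≤ ROp (k + 1)) (hH : ‖h₀ - (ctr (k + 1) g U).2‖ + ϱ * ‖w‖ ≤ RHist (k + 1))
    (bondsOf : Finset (TPt 4 (R.F.L * R.cubesPerDir (k + 1))) → Finset (Bnd R))
    (hkill : ∀ Z : (tsys 4 (R.cubesPerDir (k + 1))).Dom, ∀ ℓ ∈ torusLabels hk Z,
      ¬ (ℓ.Z₀ = trefineDom R.F.L (R.cubesPerDir (k + 1)) Z ∧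
          ℓ.P ⊆ bondsOf (ℓ.Z₀.1 \ ℓ.fam.biUnion fun Y : (tsys 4 (R.F.L * R.cubesPerDir (k + 1))).Dom => Y.1) ∧
          (ℓ.Z₀.1 \ ℓ.fam.biUnion fun Y : (tsys 4 (R.F.L * R.cubesPerDir (k + 1))).Dom => Y.1).card ≤ 2 * ℓ.P.card) →
      ∃ (b : V (domEmb R (k + 1) Z) (InnerLabel.ofTorus hk ℓ) →L[ℝ] ℝ) (thr : ℝ), thr ≤ 0 ∧
        (b, thr, true) ∈ (ℓA (domEmb R (k + 1) Z) (InnerLabel.ofTorus hk ℓ)).cons)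
    {A₀ A₁ Rkp r₁ : ℝ} (X₀ : (tsys 4 (R.cubesPerDir (k + 1))).Dom) (hA₀ : 0 ≤ A₀) (hA₁ : 0 ≤ A₁) (hr₁ : 0 ≤ r₁)
    (hrate : r₁ + 2 * (64 * Real.log 162) + 2 ≤ Rkp)
    (hsmall : (A₀ + ϱ * A₁) * Real.exp (5 * r₁ + 1) * K₀ 64 8 * 9 * 64 ≤ 1)
    {δ κ α₆ Rc b₀ s t : ℝ} (hα₆ : 0 ≤ α₆)
    (hκ : 64 * Real.log 162 + 1 ≤ δ * κ) (h229 : Real.exp 1 * K₀ 64 8 * 64 * α₆ ≤ 1)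
    (hs0 : 0 ≤ s) (hs1 : s ≤ 1) (ht : 0 ≤ t) (hb₀ : ∀ W, ((bondsOf W).card : ℝ) ≤ b₀ * W.card)
    (hRR : Rkp ≤ Rc - 64 * (Real.exp (Rc * 5) * s * Real.exp (b₀ * t)))
    (hAmp : ∀ Z : (tsys 4 (R.cubesPerDir (k + 1))).Dom, Z.1 ⊆ X₀.1 → ∀ ℓ ∈ (torusLabels hk Z).filter fun ℓ =>
        ℓ.Z₀ = trefineDom R.F.L (R.cubesPerDir (k + 1)) Z ∧
          ℓ.P ⊆ bondsOf (ℓ.Z₀.1 \ ℓ.fam.biUnion fun Y : (tsys 4 (R.F.L * R.cubesPerDir (k + 1))).Dom => Y.1) ∧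
          (ℓ.Z₀.1 \ ℓ.fam.biUnion fun Y : (tsys 4 (R.F.L * R.cubesPerDir (k + 1))).Dom => Y.1).card ≤ 2 * ℓ.P.card,
      (coreOf P Op 𝒴 dom Jc V ℓA (domEmb R (k + 1) Z) (InnerLabel.ofTorus hk ℓ)).lam.real univ *
          ((coreOf P Op 𝒴 dom Jc V ℓA (domEmb R (k + 1) Z) (InnerLabel.ofTorus hk ℓ)).wB *
              N₀ (k + 1) (domEmb R (k + 1) Z, InnerLabel.ofTorus hk ℓ) (domEmb R (k + 1) Z) *
            Real.exp (bq (k + 1) (domEmb R (k + 1) Z, InnerLabel.ofTorus hk ℓ) (domEmb R (k + 1) Z))) *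
          (Real.pi / (mq (k + 1) (domEmb R (k + 1) Z, InnerLabel.ofTorus hk ℓ) (domEmb R (k + 1) Z) / 2)) ^
            (Module.finrank ℝ (V (domEmb R (k + 1) Z) (InnerLabel.ofTorus hk ℓ)) / 2 : ℝ) *
        Real.exp ((coreOf P Op 𝒴 dom Jc V ℓA (domEmb R (k + 1) Z) (InnerLabel.ofTorus hk ℓ)).N₁ * (‖h₀‖ + ϱ * ‖w‖)) ≤
      (A₀ + ϱ * A₁) * ((∏ Y ∈ ℓ.fam, (α₆ * Real.exp (-(δ * κ * torusTreeLen Y.1)) *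
        Real.exp (-(Rc * (torusTreeLen Y.1 + 5))))) * (s ^ 2 * t) ^ ℓ.P.card))
    (hϱ : 2 ≤ ϱ) (hϱA : A₀ ≤ ϱ * A₁) :
    ‖locE (tgeometry 4 (R.cubesPerDir (k + 1))).ι (tgeometry 4 (R.cubesPerDir (k + 1))).cubes
          (fun Z => ∑ ℓ' ∈ innerLabels (b13InnerData R) (k + 1) (domEmb R (k + 1) Z),
            actOfLetters P Op 𝒴 dom Jc V ℓA (domEmb R (k + 1) Z) ℓ' o (h₀ + w)) ((tgeometry 4 (R.cubesPerDir (k + 1))).cubes X₀) -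
        locE (tgeometry 4 (R.cubesPerDir (k + 1))).ι (tgeometry 4 (R.cubesPerDir (k + 1))).cubes
          (fun Z => ∑ ℓ' ∈ innerLabels (b13InnerData R) (k + 1) (domEmb R (k + 1) Z),
            actOfLetters P Op 𝒴 dom Jc V ℓA (domEmb R (k + 1) Z) ℓ' o h₀) ((tgeometry 4 (R.cubesPerDir (k + 1))).cubes X₀)‖ ≤
      4 * (Real.exp 1 * 9 * 64 * K₀ 64 8 ^ 2) * A₁ * Real.exp (-(r₁ * (tsys 4 (R.cubesPerDir (k + 1))).dj X₀)) := by
  have h := attachedPart_locE_le_of_actOfLetters_recordLabels_refined P Op 𝒴 dom Jc V ℓA hroom hm hN hq hg hO hH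
    (emb := fun Z => domEmb R (k + 1) Z) (fun _ => rfl) (torusLabels hk)
    (fun Z => (torusLabels hk Z).filter fun ℓ =>
        ℓ.Z₀ = trefineDom R.F.L (R.cubesPerDir (k + 1)) Z ∧
          ℓ.P ⊆ bondsOf (ℓ.Z₀.1 \ ℓ.fam.biUnion fun Y : (tsys 4 (R.F.L * R.cubesPerDir (k + 1))).Dom => Y.1) ∧
          (ℓ.Z₀.1 \ ℓ.fam.biUnion fun Y : (tsys 4 (R.F.L * R.cubesPerDir (k + 1))).Dom => Y.1).card ≤ 2 * ℓ.P.card)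
    (fun Z => Finset.filter_subset _ _) (fun _ => InnerLabel.ofTorus hk) (fun _ => InnerLabel.ofTorus_injective hk)
    (fun Z ℓ hℓ hnot => hkill Z ℓ hℓ fun hfine => hnot (Finset.mem_filter.2 ⟨hℓ, hfine⟩))
    X₀ hA₀ hA₁ hr₁ hrate hsmall bondsOf hα₆ hκ h229 hs0 hs1 ht hb₀ hRR
    (fun Z ℓ hℓ => by
      obtain ⟨hT, h1, h3, h4⟩ := Finset.mem_filter.1 hℓ
      exact ⟨h1, ((mem_torusLabels_iff hk).1 hT).1, h3, h4⟩)
    hAmp hϱ hϱA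
  rw [locE_congr (ι := (tgeometry 4 (R.cubesPerDir (k + 1))).ι) (cubes := (tgeometry 4 (R.cubesPerDir (k + 1))).cubes) (X := (tgeometry 4 (R.cubesPerDir (k + 1))).cubes X₀)
      (w := fun Z => ∑ ℓ' ∈ innerLabels (b13InnerData R) (k + 1) (domEmb R (k + 1) Z),
        actOfLetters P Op 𝒴 dom Jc V ℓA (domEmb R (k + 1) Z) ℓ' o (h₀ + w))
      (w' := fun Z => ∑ ℓ ∈ torusLabels hk Z, actOfLetters P Op 𝒴 dom Jc V ℓA (domEmb R (k + 1) Z) (InnerLabel.ofTorus hk ℓ) o (h₀ + w))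
      (fun Z _ => sum_innerLabels_domEmb_eq hk Z _),
    locE_congr (ι := (tgeometry 4 (R.cubesPerDir (k + 1))).ι) (cubes := (tgeometry 4 (R.cubesPerDir (k + 1))).cubes) (X := (tgeometry 4 (R.cubesPerDir (k + 1))).cubes X₀)
      (w := fun Z => ∑ ℓ' ∈ innerLabels (b13InnerData R) (k + 1) (domEmb R (k + 1) Z),
        actOfLetters P Op 𝒴 dom Jc V ℓA (domEmb R (k + 1) Z) ℓ' o h₀)
      (w' := fun Z => ∑ ℓ ∈ torusLabels hk Z, actOfLetters P Op 𝒴 dom Jc V ℓA (domEmb R (k + 1) Z) (InnerLabel.ofTorus hk ℓ) o h₀)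
      (fun Z _ => sum_innerLabels_domEmb_eq hk Z _)]
  exact h

open Classical in
/-- **THE μ-PART (ROAD P1's SOURCE PENCIL) OF ROW NE5's CATALOGUE ACTIVITY AT THE CARRIERS OF RECORD, THE SECOND-STEP COUNT AND THE
INDEXING DISCHARGED** (kernel; §1's μ-END ONCE with the plug-ins of the attached carriers END above).  The source window `μ₁`∕`μ₀`∕`sμ` and
the direction `v` occur ONLY in `hH`, `hAmp` and the conclusion:
`‖E[Z ↦ Σ_{ℓ' ∈ innerLabels … (domEmb R (k+1) Z)} actOfLetters ℓA (domEmb R (k+1) Z) ℓ' o (h₀ + sμ•v)](X₀) − E[… o h₀](X₀)‖ ≤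
e·9·64·K₀(64,8)²·A·e^{−r₁·torusTreeLen X₀}·μ₀∕(μ₁ − μ₀)`. [folklore] -/
theorem muPart_locE_le_of_actOfLetters_recordLabels_carriers {Win : Set (ℕ → ℝ)}
    {ctr : ℕ → (ℕ → ℝ) → R.carriers.BgB → Op × B13HistM P} {ROp RHist R' : ℕ → ℝ}
    (ℓA : ∀ X j, CoreLetters P Op 𝒴 dom Jc V X j)
    {mq bq N₀ : ℕ → R.carriers.Dom × InnerLabel R.carriers.Dom (Bnd R) → R.carriers.Dom → ℝ}
    (hroom : ∀ k, ROp k < R' k)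
    (hm : ∀ k, ∀ g ∈ Win, ∀ (U : R.carriers.BgB) (X : R.carriers.Dom), R.carriers.scale X = k → ∀ p, 0 < mq k p X)
    (hN : ∀ k, ∀ g ∈ Win, ∀ (U : R.carriers.BgB) (X : R.carriers.Dom), R.carriers.scale X = k →
      ∀ p : R.carriers.Dom × InnerLabel R.carriers.Dom (Bnd R),
      (∀ o ∈ ball (ctr k g U).1 (R' k),
        AEStronglyMeasurable ((ℓA p.1 p.2).N o) (coreOf P Op 𝒴 dom Jc V ℓA p.1 p.2).lam) ∧
      (∀ a, DifferentiableOn ℂ (fun o => (ℓA p.1 p.2).N o a) (ball (ctr k g U).1 (R' k))) ∧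
      (∀ o ∈ ball (ctr k g U).1 (R' k), ∀ a, ‖(ℓA p.1 p.2).N o a‖ ≤ N₀ k p X))
    (hq : ∀ k, ∀ g ∈ Win, ∀ (U : R.carriers.BgB) (X : R.carriers.Dom), R.carriers.scale X = k →
      ∀ p : R.carriers.Dom × InnerLabel R.carriers.Dom (Bnd R),
      (∀ o ∈ ball (ctr k g U).1 (R' k),
        AEStronglyMeasurable (Function.uncurry ((ℓA p.1 p.2).q o))
          ((coreOf P Op 𝒴 dom Jc V ℓA p.1 p.2).lam.prod volume)) ∧
      (∀ a v, DifferentiableOn ℂ (fun o => (ℓA p.1 p.2).q o a v) (ball (ctr k g U).1 (R' k))) ∧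
      (∀ o ∈ ball (ctr k g U).1 (R' k), ∀ a v, mq k p X * ‖v‖ ^ 2 - bq k p X ≤ ((ℓA p.1 p.2).q o a v).re))
    {g : ℕ → ℝ} (hg : g ∈ Win) {U : R.carriers.BgB} {o : Op} {h₀ v : B13HistM P} {μ₁ : ℝ}
    (hO : ‖o - (ctr (k + 1) g U).1‖ ≤ ROp (k + 1)) (hH : ‖h₀ - (ctr (k + 1) g U).2‖ + μ₁ * ‖v‖ ≤ RHist (k + 1))
    (bondsOf : Finset (TPt 4 (R.F.L * R.cubesPerDir (k + 1))) → Finset (Bnd R))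
    (hkill : ∀ Z : (tsys 4 (R.cubesPerDir (k + 1))).Dom, ∀ ℓ ∈ torusLabels hk Z,
      ¬ (ℓ.Z₀ = trefineDom R.F.L (R.cubesPerDir (k + 1)) Z ∧
          ℓ.P ⊆ bondsOf (ℓ.Z₀.1 \ ℓ.fam.biUnion fun Y : (tsys 4 (R.F.L * R.cubesPerDir (k + 1))).Dom => Y.1) ∧
          (ℓ.Z₀.1 \ ℓ.fam.biUnion fun Y : (tsys 4 (R.F.L * R.cubesPerDir (k + 1))).Dom => Y.1).card ≤ 2 * ℓ.P.card) →
      ∃ (b : V (domEmb R (k + 1) Z) (InnerLabel.ofTorus hk ℓ) →L[ℝ] ℝ) (thr : ℝ), thr ≤ 0 ∧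
        (b, thr, true) ∈ (ℓA (domEmb R (k + 1) Z) (InnerLabel.ofTorus hk ℓ)).cons)
    {A Rkp r₁ μ₀ : ℝ} (X₀ : (tsys 4 (R.cubesPerDir (k + 1))).Dom) {sμ : ℂ} (hA : 0 ≤ A) (hr₁ : 0 ≤ r₁)
    (hrate : r₁ + 2 * (64 * Real.log 162) + 2 ≤ Rkp)
    (hsmall : A * Real.exp (5 * r₁ + 1) * K₀ 64 8 * 9 * 64 ≤ 1)
    {δ κ α₆ Rc b₀ s t : ℝ} (hα₆ : 0 ≤ α₆)
    (hκ : 64 * Real.log 162 + 1 ≤ δ * κ) (h229 : Real.exp 1 * K₀ 64 8 * 64 * α₆ ≤ 1)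
    (hs0 : 0 ≤ s) (hs1 : s ≤ 1) (ht : 0 ≤ t) (hb₀ : ∀ W, ((bondsOf W).card : ℝ) ≤ b₀ * W.card)
    (hRR : Rkp ≤ Rc - 64 * (Real.exp (Rc * 5) * s * Real.exp (b₀ * t)))
    (hAmp : ∀ Z : (tsys 4 (R.cubesPerDir (k + 1))).Dom, Z.1 ⊆ X₀.1 → ∀ ℓ ∈ (torusLabels hk Z).filter fun ℓ =>
        ℓ.Z₀ = trefineDom R.F.L (R.cubesPerDir (k + 1)) Z ∧
          ℓ.P ⊆ bondsOf (ℓ.Z₀.1 \ ℓ.fam.biUnion fun Y : (tsys 4 (R.F.L * R.cubesPerDir (k + 1))).Dom => Y.1) ∧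
          (ℓ.Z₀.1 \ ℓ.fam.biUnion fun Y : (tsys 4 (R.F.L * R.cubesPerDir (k + 1))).Dom => Y.1).card ≤ 2 * ℓ.P.card,
      (coreOf P Op 𝒴 dom Jc V ℓA (domEmb R (k + 1) Z) (InnerLabel.ofTorus hk ℓ)).lam.real univ *
          ((coreOf P Op 𝒴 dom Jc V ℓA (domEmb R (k + 1) Z) (InnerLabel.ofTorus hk ℓ)).wB *
              N₀ (k + 1) (domEmb R (k + 1) Z, InnerLabel.ofTorus hk ℓ) (domEmb R (k + 1) Z) *
            Real.exp (bq (k + 1) (domEmb R (k + 1) Z, InnerLabel.ofTorus hk ℓ) (domEmb R (k + 1) Z))) *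
          (Real.pi / (mq (k + 1) (domEmb R (k + 1) Z, InnerLabel.ofTorus hk ℓ) (domEmb R (k + 1) Z) / 2)) ^
            (Module.finrank ℝ (V (domEmb R (k + 1) Z) (InnerLabel.ofTorus hk ℓ)) / 2 : ℝ) *
        Real.exp ((coreOf P Op 𝒴 dom Jc V ℓA (domEmb R (k + 1) Z) (InnerLabel.ofTorus hk ℓ)).N₁ * (‖h₀‖ + μ₁ * ‖v‖)) ≤
      A * ((∏ Y ∈ ℓ.fam, (α₆ * Real.exp (-(δ * κ * torusTreeLen Y.1)) *
        Real.exp (-(Rc * (torusTreeLen Y.1 + 5))))) * (s ^ 2 * t) ^ ℓ.P.card))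
    (h0 : 0 < μ₀) (h01 : μ₀ < μ₁) (hμ : ‖sμ‖ ≤ μ₀) :
    ‖locE (tgeometry 4 (R.cubesPerDir (k + 1))).ι (tgeometry 4 (R.cubesPerDir (k + 1))).cubes
          (fun Z => ∑ ℓ' ∈ innerLabels (b13InnerData R) (k + 1) (domEmb R (k + 1) Z),
            actOfLetters P Op 𝒴 dom Jc V ℓA (domEmb R (k + 1) Z) ℓ' o (h₀ + sμ • v)) ((tgeometry 4 (R.cubesPerDir (k + 1))).cubes X₀) -
        locE (tgeometry 4 (R.cubesPerDir (k + 1))).ι (tgeometry 4 (R.cubesPerDir (k + 1))).cubes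
          (fun Z => ∑ ℓ' ∈ innerLabels (b13InnerData R) (k + 1) (domEmb R (k + 1) Z),
            actOfLetters P Op 𝒴 dom Jc V ℓA (domEmb R (k + 1) Z) ℓ' o h₀) ((tgeometry 4 (R.cubesPerDir (k + 1))).cubes X₀)‖ ≤
      Real.exp 1 * 9 * 64 * K₀ 64 8 ^ 2 * A * Real.exp (-(r₁ * (tsys 4 (R.cubesPerDir (k + 1))).dj X₀)) * (μ₀ / (μ₁ - μ₀)) := by
  have h := muPart_locE_le_of_actOfLetters_recordLabels_refined P Op 𝒴 dom Jc V ℓA hroom hm hN hq hg hO hH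
    (emb := fun Z => domEmb R (k + 1) Z) (fun _ => rfl) (torusLabels hk)
    (fun Z => (torusLabels hk Z).filter fun ℓ =>
        ℓ.Z₀ = trefineDom R.F.L (R.cubesPerDir (k + 1)) Z ∧
          ℓ.P ⊆ bondsOf (ℓ.Z₀.1 \ ℓ.fam.biUnion fun Y : (tsys 4 (R.F.L * R.cubesPerDir (k + 1))).Dom => Y.1) ∧
          (ℓ.Z₀.1 \ ℓ.fam.biUnion fun Y : (tsys 4 (R.F.L * R.cubesPerDir (k + 1))).Dom => Y.1).card ≤ 2 * ℓ.P.card)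
    (fun Z => Finset.filter_subset _ _) (fun _ => InnerLabel.ofTorus hk) (fun _ => InnerLabel.ofTorus_injective hk)
    (fun Z ℓ hℓ hnot => hkill Z ℓ hℓ fun hfine => hnot (Finset.mem_filter.2 ⟨hℓ, hfine⟩))
    X₀ hA hr₁ hrate hsmall bondsOf hα₆ hκ h229 hs0 hs1 ht hb₀ hRR
    (fun Z ℓ hℓ => by
      obtain ⟨hT, h1, h3, h4⟩ := Finset.mem_filter.1 hℓ
      exact ⟨h1, ((mem_torusLabels_iff hk).1 hT).1, h3, h4⟩)
    hAmp h0 h01 hμ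
  rw [locE_congr (ι := (tgeometry 4 (R.cubesPerDir (k + 1))).ι) (cubes := (tgeometry 4 (R.cubesPerDir (k + 1))).cubes) (X := (tgeometry 4 (R.cubesPerDir (k + 1))).cubes X₀)
      (w := fun Z => ∑ ℓ' ∈ innerLabels (b13InnerData R) (k + 1) (domEmb R (k + 1) Z),
        actOfLetters P Op 𝒴 dom Jc V ℓA (domEmb R (k + 1) Z) ℓ' o (h₀ + sμ • v))
      (w' := fun Z => ∑ ℓ ∈ torusLabels hk Z, actOfLetters P Op 𝒴 dom Jc V ℓA (domEmb R (k + 1) Z) (InnerLabel.ofTorus hk ℓ) o (h₀ + sμ • v))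
      (fun Z _ => sum_innerLabels_domEmb_eq hk Z _),
    locE_congr (ι := (tgeometry 4 (R.cubesPerDir (k + 1))).ι) (cubes := (tgeometry 4 (R.cubesPerDir (k + 1))).cubes) (X := (tgeometry 4 (R.cubesPerDir (k + 1))).cubes X₀)
      (w := fun Z => ∑ ℓ' ∈ innerLabels (b13InnerData R) (k + 1) (domEmb R (k + 1) Z),
        actOfLetters P Op 𝒴 dom Jc V ℓA (domEmb R (k + 1) Z) ℓ' o h₀)
      (w' := fun Z => ∑ ℓ ∈ torusLabels hk Z, actOfLetters P Op 𝒴 dom Jc V ℓA (domEmb R (k + 1) Z) (InnerLabel.ofTorus hk ℓ) o h₀)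
      (fun Z _ => sum_innerLabels_domEmb_eq hk Z _)]
  exact h

end Carriers

end Summit.QuantumFields.BalabanUV.T4Continuum.NE1p.DressedSmallFieldRecordLabelsCarriers

end
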